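import Literature.Computability.Learning.LearnerHypFP
import Literature.Computability.Complexity.IWReconstructionEvaluator
import HarnessLib

/-!
# IW98 Lemma 15, the construction: one run of the CIKK reconstruction as a weak stage (queries)

Literature / complexity — derandomization under a uniform assumption (Case 2 of the printed proof
of `impagliazzoWigderson1998` = van Melkebeek Thm. 6.2.1 = IW98 Thm. 5). The select-by-testing
transducer (`UniformDerandomizationSelectTransducer.lean`, `IWUniform.reducibleUsing_of_weakStage`)
turns any WEAK one-run stage — two `FP` maps: run query `u` on `⟨⟨1ⁿ, run block⟩, 1ᵘ⟩` and the
candidate on `⟨⟨1ⁿ, ⟨z, run block⟩⟩, answers⟩` — into IW's `A →^{fₙ} C^{f,1−2/D}`. The weak stage of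
IW98's Lemma 15 (§2.4, Lemmas 18–20: NW predictor with oracle tables, Goldreich–Levin, uniform
direct-product decoding) is ONE RUN of the reconstruction of Carmosino–Impagliazzo–Kabanets–
Kolokolova (CCC 2016, §5), whose machine layer the tree holds (`Learning/LearnerTablesFP.lean`,
`LearnerHypFP.lean`, …) and whose counting theorem `Learning.card_goodRun_ge` is generic in the test.
This file supplies the QUERY map of that stage at explicit, caller-chosen parameters (read off `1ⁿ`
by `FP` maps `kF, LF, ℓF, kkF, κF, tF`: `k = 2^κ`, `L = 2^ℓ`, `kk`, `t`; the field size is the least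
prime `q ≥ kn + k`, `Learning.leastPrimeFn`):

* `IWStage.runLenP`, `segP` — CIKK's run-coin length `runLen n k ℓ kk t q κ` in unary and the run
  coins proper: the stage reads the first `runLen` bits of its (possibly longer) run block (the
  padding convention of the transducer); `tblCtxP` — CIKK's table context of the run
  (`tblCtxP_apply`: block `i` and seed `z` decoded exactly as `Learning.coinsToRun` does);
* **`IWStage.qryS`** — the query of flat index `u`: for `u = (jL + c)k + blk` (`j, c < L`, `blk < k`)
  the `blk`-th `n`-bit block of the pattern input of table entry `(j, c)` of the run
  (`LearnerTablesFP.patInputFn`, `AmpEvalFP.blockFn` — the membership query whose answer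
  `LearnerTablesFP.AnswersOK` expects at that index); for `u = L²k + blk` the `blk`-th point of the
  trusted tuple; past `L²k + k` the dummy query `0ⁿ`; `qryS_mem_FP`;
* the values: `qryS_apply_table` (index `(jL + c)k + blk`), `qryS_apply_lt` (any `u < L²k`),
  `qryS_apply_trusted`, `qryS_apply_dummy`, and **`length_qryS`** (every query has length `n` — the hypothesis `hQlen` of
  `IWUniform.reducibleUsing_of_weakStage`).

Everything is proved; the definitions are explicit string functions (no named facts). (Sequel: the
candidate map via `Learning.hypFn` and `IWRecon.setPadFn`, and the weak success bound via
`Learning.card_goodRun_ge` and `LearnerCoinsBij.card_filter_seg_eq`.)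

## References

* [ImpagliazzoWigderson2001] R. Impagliazzo, A. Wigderson, JCSS 63 (2001) 672–688, Lemma 15 and
  §2.4 (Lemmas 18–20: "we need to verify that the use of non-uniformity can be replaced by an
  oracle for fₙ"; held text pp. 7–8).
* [CarmosinoImpagliazzoKabanetsKolokolova2016] CCC 2016, §5 (complete algorithm, step 2: the
  tables of `AMP(f)` by membership queries; step 5: the trusted tuple).
-/

noncomputable section

namespace Literature.Computability.Complexity

namespace IWStage

open _root_.Computability Polynomial Brick Plumb HashBricks Literature.Computability.Learning
  Literature.Computability.MetaComplexity Literature.Computability.MetaComplexity.MCSPVerif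

variable (kF LF ℓF kkF κF tF : List Bool → List Bool)

/-! ### Unary parameters on `⟨1ⁿ, rb⟩` -/

/-- `1ⁿ` on `⟨1ⁿ, rb⟩`. [folklore] -/
def nP : List Bool → List Bool := fstF
/-- `1^{kn+k}`. [folklore] -/
def knkP : List Bool → List Bool := appF ∘ fanoutFn (umulFn ∘ fanoutFn (kF ∘ nP) nP) (kF ∘ nP)
/-- `1^q`, `q` the least prime `≥ kn + k`. [cite: CarmosinoImpagliazzoKabanetsKolokolova2016, §5] -/
def qP : List Bool → List Bool := leastPrimeFn ∘ knkP kF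
/-- `1^{offA}`, `offA = ℓ + q² + L + kk·k + kk + k` (offset of the trusted tuple in the run coins). [folklore] -/
def offAP : List Bool → List Bool :=
  appF ∘ fanoutFn (ℓF ∘ nP) (appF ∘ fanoutFn (umulFn ∘ fanoutFn (qP kF) (qP kF)) (appF ∘ fanoutFn (LF ∘ nP)
    (appF ∘ fanoutFn (umulFn ∘ fanoutFn (kkF ∘ nP) (kF ∘ nP)) (appF ∘ fanoutFn (kkF ∘ nP) (kF ∘ nP)))))
/-- `1^{runLen}`, `runLen = offA + kn + t(κ + kn)` (CIKK's `runLen n k ℓ kk t q κ`). [folklore] -/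
def runLenP : List Bool → List Bool :=
  appF ∘ fanoutFn (offAP kF LF ℓF kkF) (appF ∘ fanoutFn (umulFn ∘ fanoutFn (kF ∘ nP) nP)
    (umulFn ∘ fanoutFn (tF ∘ nP) (appF ∘ fanoutFn (κF ∘ nP) (umulFn ∘ fanoutFn (kF ∘ nP) nP))))
/-- The run coins proper: the first `runLen` bits of the run block. [folklore] -/
def segP : List Bool → List Bool := takeFn ∘ fanoutFn (runLenP kF LF ℓF kkF κF tF) sndF
/-- `1^{L²k}`, the number of table queries. [folklore] -/
def llkP : List Bool → List Bool := umulFn ∘ fanoutFn (umulFn ∘ fanoutFn (LF ∘ nP) (LF ∘ nP)) (kF ∘ nP)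
/-- **The table context** `⟨hdr, ⟨ibits, ⟨zbits, ⟨1ⁿ, 1ᵏ⟩⟩⟩⟩`, `hdr = ⟨ε, ⟨1^q, ⟨1^ℓ, ⟨1^{kn+k}, 1^L⟩⟩⟩⟩`
(`LearnerTablesFP.tblCtx`), on `⟨1ⁿ, rb⟩`. [folklore] -/
def tblCtxP : List Bool → List Bool :=
  fanoutFn (fanoutFn (fun _ => []) (fanoutFn (qP kF) (fanoutFn (ℓF ∘ nP) (fanoutFn (knkP kF) (LF ∘ nP)))))
    (fanoutFn (takeFn ∘ fanoutFn (ℓF ∘ nP) (segP kF LF ℓF kkF κF tF))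
      (fanoutFn (takeFn ∘ fanoutFn (umulFn ∘ fanoutFn (qP kF) (qP kF)) (dropFn ∘ fanoutFn (ℓF ∘ nP) (segP kF LF ℓF kkF κF tF)))
        (fanoutFn nP (kF ∘ nP))))

/-! ### The query map -/

/-- **The run query of flat index `u`** on `w = ⟨⟨1ⁿ, rb⟩, 1ᵘ⟩`: a table query (block `u mod k` of the
pattern input of entry `(u / (Lk), (u / k) mod L)`), a trusted-tuple point, or the dummy `0ⁿ`.
[cite: CarmosinoImpagliazzoKabanetsKolokolova2016, §5 (steps 2 and 5)] [cite: ImpagliazzoWigderson2001, §2.4] -/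
def qryS : List Bool → List Bool :=
  iteFn (ltLenF ∘ fanoutFn sndF (llkP kF LF ∘ fstF))
    -- table query: blockFn ⟨⟨1ⁿ, 1^{u mod k}⟩, patInputFn ⟨⟨TC, 1^{u/(Lk)}⟩, 1^{(u/k) mod L}⟩⟩
    (blockFn ∘ fanoutFn
      (fanoutFn (nP ∘ fstF) (sndF ∘ divModFn ∘ fanoutFn (kF ∘ nP ∘ fstF) sndF))
      (patInputFn ∘ fanoutFn
        (fanoutFn (tblCtxP kF LF ℓF kkF κF tF ∘ fstF)
          (fstF ∘ divModFn ∘ fanoutFn (umulFn ∘ fanoutFn (LF ∘ nP ∘ fstF) (kF ∘ nP ∘ fstF)) sndF))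
        (sndF ∘ divModFn ∘ fanoutFn (LF ∘ nP ∘ fstF) (fstF ∘ divModFn ∘ fanoutFn (kF ∘ nP ∘ fstF) sndF))))
    (iteFn (ltLenF ∘ fanoutFn sndF (appF ∘ fanoutFn (llkP kF LF ∘ fstF) (kF ∘ nP ∘ fstF)))
      -- trusted-tuple point `blk = u − L²k`: `(seg ⇂ (offA + blk·n)) ↾ n`
      (takeFn ∘ fanoutFn (nP ∘ fstF)
        (dropFn ∘ fanoutFn
          (appF ∘ fanoutFn (offAP kF LF ℓF kkF ∘ fstF)
            (umulFn ∘ fanoutFn (dropFn ∘ fanoutFn (llkP kF LF ∘ fstF) sndF) (nP ∘ fstF)))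
          (segP kF LF ℓF kkF κF tF ∘ fstF)))
      -- dummy
      (Kannan.zerosFn ∘ nP ∘ fstF))

/-! ### Membership in `FP` -/

section FP

variable {kF LF ℓF kkF κF tF} (hk : kF ∈ FP) (hL : LF ∈ FP) (hℓ : ℓF ∈ FP) (hkk : kkF ∈ FP) (hκ : κF ∈ FP) (ht : tF ∈ FP)
include hk

/-- `knkP` is in `FP`. [folklore] -/
theorem knkP_mem_FP : knkP kF ∈ FP :=
  comp_mem_FP appF_mem_FP (fanoutFn_mem_FP (comp_mem_FP umulFn_mem_FP (fanoutFn_mem_FP (comp_mem_FP hk fstF_mem_FP) fstF_mem_FP))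
    (comp_mem_FP hk fstF_mem_FP))
/-- `qP` is in `FP`. [folklore] -/
theorem qP_mem_FP : qP kF ∈ FP := comp_mem_FP leastPrimeFn_mem_FP (knkP_mem_FP hk)

include hL hℓ hkk
/-- `offAP` is in `FP`. [folklore] -/
theorem offAP_mem_FP : offAP kF LF ℓF kkF ∈ FP :=
  comp_mem_FP appF_mem_FP (fanoutFn_mem_FP (comp_mem_FP hℓ fstF_mem_FP) (comp_mem_FP appF_mem_FP (fanoutFn_mem_FP
    (comp_mem_FP umulFn_mem_FP (fanoutFn_mem_FP (qP_mem_FP hk) (qP_mem_FP hk))) (comp_mem_FP appF_mem_FP (fanoutFn_mem_FP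
      (comp_mem_FP hL fstF_mem_FP) (comp_mem_FP appF_mem_FP (fanoutFn_mem_FP
        (comp_mem_FP umulFn_mem_FP (fanoutFn_mem_FP (comp_mem_FP hkk fstF_mem_FP) (comp_mem_FP hk fstF_mem_FP)))
        (comp_mem_FP appF_mem_FP (fanoutFn_mem_FP (comp_mem_FP hkk fstF_mem_FP) (comp_mem_FP hk fstF_mem_FP))))))))))

include hκ ht
/-- `runLenP` is in `FP`. [folklore] -/
theorem runLenP_mem_FP : runLenP kF LF ℓF kkF κF tF ∈ FP :=
  comp_mem_FP appF_mem_FP (fanoutFn_mem_FP (offAP_mem_FP hk hL hℓ hkk) (comp_mem_FP appF_mem_FP (fanoutFn_mem_FP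
    (comp_mem_FP umulFn_mem_FP (fanoutFn_mem_FP (comp_mem_FP hk fstF_mem_FP) fstF_mem_FP))
    (comp_mem_FP umulFn_mem_FP (fanoutFn_mem_FP (comp_mem_FP ht fstF_mem_FP) (comp_mem_FP appF_mem_FP (fanoutFn_mem_FP
      (comp_mem_FP hκ fstF_mem_FP) (comp_mem_FP umulFn_mem_FP (fanoutFn_mem_FP (comp_mem_FP hk fstF_mem_FP) fstF_mem_FP)))))))))
/-- `segP` is in `FP`. [folklore] -/
theorem segP_mem_FP : segP kF LF ℓF kkF κF tF ∈ FP :=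
  comp_mem_FP takeFn_mem_FP (fanoutFn_mem_FP (runLenP_mem_FP hk hL hℓ hkk hκ ht) sndF_mem_FP)

omit hℓ hkk hκ ht in
/-- `llkP` is in `FP`. [folklore] -/
theorem llkP_mem_FP : llkP kF LF ∈ FP :=
  comp_mem_FP umulFn_mem_FP (fanoutFn_mem_FP (comp_mem_FP umulFn_mem_FP (fanoutFn_mem_FP (comp_mem_FP hL fstF_mem_FP)
    (comp_mem_FP hL fstF_mem_FP))) (comp_mem_FP hk fstF_mem_FP))

/-- `tblCtxP` is in `FP`. [folklore] -/
theorem tblCtxP_mem_FP : tblCtxP kF LF ℓF kkF κF tF ∈ FP :=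
  fanoutFn_mem_FP (fanoutFn_mem_FP (const_mem_FP _) (fanoutFn_mem_FP (qP_mem_FP hk) (fanoutFn_mem_FP (comp_mem_FP hℓ fstF_mem_FP)
    (fanoutFn_mem_FP (knkP_mem_FP hk) (comp_mem_FP hL fstF_mem_FP)))))
    (fanoutFn_mem_FP (comp_mem_FP takeFn_mem_FP (fanoutFn_mem_FP (comp_mem_FP hℓ fstF_mem_FP) (segP_mem_FP hk hL hℓ hkk hκ ht)))
      (fanoutFn_mem_FP (comp_mem_FP takeFn_mem_FP (fanoutFn_mem_FP (comp_mem_FP umulFn_mem_FP (fanoutFn_mem_FP (qP_mem_FP hk) (qP_mem_FP hk)))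
        (comp_mem_FP dropFn_mem_FP (fanoutFn_mem_FP (comp_mem_FP hℓ fstF_mem_FP) (segP_mem_FP hk hL hℓ hkk hκ ht)))))
        (fanoutFn_mem_FP fstF_mem_FP (comp_mem_FP hk fstF_mem_FP))))

/-- **`qryS ∈ FP`.** [cite: AroraBarakCC2009, §1.3] -/
theorem qryS_mem_FP : qryS kF LF ℓF kkF κF tF ∈ FP := by
  have hn1 : (nP ∘ fstF) ∈ FP := comp_mem_FP fstF_mem_FP fstF_mem_FP
  have hkn1 : (kF ∘ nP ∘ fstF) ∈ FP := comp_mem_FP hk hn1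
  have hLn1 : (LF ∘ nP ∘ fstF) ∈ FP := comp_mem_FP hL hn1
  have hdk : (divModFn ∘ fanoutFn (kF ∘ nP ∘ fstF) sndF) ∈ FP := comp_mem_FP divModFn_mem_FP (fanoutFn_mem_FP hkn1 sndF_mem_FP)
  refine iteFn_mem_FP (comp_mem_FP ltLenF_mem_FP (fanoutFn_mem_FP sndF_mem_FP (comp_mem_FP (llkP_mem_FP hk hL) fstF_mem_FP))) ?_ ?_
  · exact comp_mem_FP blockFn_mem_FP (fanoutFn_mem_FP (fanoutFn_mem_FP hn1 (comp_mem_FP sndF_mem_FP hdk))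
      (comp_mem_FP patInputFn_mem_FP (fanoutFn_mem_FP
        (fanoutFn_mem_FP (comp_mem_FP (tblCtxP_mem_FP hk hL hℓ hkk hκ ht) fstF_mem_FP)
          (comp_mem_FP fstF_mem_FP (comp_mem_FP divModFn_mem_FP (fanoutFn_mem_FP (comp_mem_FP umulFn_mem_FP (fanoutFn_mem_FP hLn1 hkn1)) sndF_mem_FP))))
        (comp_mem_FP sndF_mem_FP (comp_mem_FP divModFn_mem_FP (fanoutFn_mem_FP hLn1 (comp_mem_FP fstF_mem_FP hdk)))))))
  · refine iteFn_mem_FP (comp_mem_FP ltLenF_mem_FP (fanoutFn_mem_FP sndF_mem_FP (comp_mem_FP appF_mem_FP (fanoutFn_mem_FP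
      (comp_mem_FP (llkP_mem_FP hk hL) fstF_mem_FP) hkn1)))) ?_ (comp_mem_FP Kannan.zerosFn_mem_FP hn1)
    exact comp_mem_FP takeFn_mem_FP (fanoutFn_mem_FP hn1 (comp_mem_FP dropFn_mem_FP (fanoutFn_mem_FP
      (comp_mem_FP appF_mem_FP (fanoutFn_mem_FP (comp_mem_FP (offAP_mem_FP hk hL hℓ hkk) fstF_mem_FP)
        (comp_mem_FP umulFn_mem_FP (fanoutFn_mem_FP (comp_mem_FP dropFn_mem_FP (fanoutFn_mem_FP (comp_mem_FP (llkP_mem_FP hk hL) fstF_mem_FP) sndF_mem_FP)) hn1))))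
      (comp_mem_FP (segP_mem_FP hk hL hℓ hkk hκ ht) fstF_mem_FP))))

end FP

/-! ### Values -/

section Values

variable {kF LF ℓF kkF κF tF} {n k ℓ kk κ t : ℕ}
  (hkF : kF (ones n) = ones k) (hLF : LF (ones n) = ones (2 ^ ℓ)) (hℓF : ℓF (ones n) = ones ℓ)
  (hkkF : kkF (ones n) = ones kk) (hκF : κF (ones n) = ones κ) (htF : tF (ones n) = ones t)

/-- The field size: the least prime `≥ kn + k`. [cite: CarmosinoImpagliazzoKabanetsKolokolova2016, §5] -/
def qOf (n k : ℕ) : ℕ := prmQ (k * n + k)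

/-- `qOf` is prime. [folklore] -/
instance qOf_prime (n k : ℕ) : Fact (qOf n k).Prime := ⟨(prmQ_spec _).2⟩

/-- `kn + k ≤ q`. [folklore] -/
theorem knk_le_qOf (n k : ℕ) : k * n + k ≤ qOf n k := (prmQ_spec _).1

/-- `1ᵃ ++ 1ᵇ = 1ᵃ⁺ᵇ`. [folklore] -/
private theorem ones_append (a b : ℕ) : ones a ++ ones b = ones (a + b) := List.replicate_append_replicate ..

variable (rb : List Bool)

include hkF in
/-- Value of `knkP`. [folklore] -/
theorem knkP_apply : knkP kF (boolPair (ones n) rb) = ones (k * n + k) := by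
  simp [knkP, nP, hkF, umulFn_boolPair, Nat.mul_comm]

include hkF in
/-- Value of `qP`: `1^q`. [folklore] -/
theorem qP_apply : qP kF (boolPair (ones n) rb) = ones (qOf n k) := by
  rw [qP, Function.comp_apply, knkP_apply hkF, leastPrimeFn_apply, qOf]

include hkF hLF hℓF hkkF in
/-- Value of `offAP`: `1^{offA}`. [folklore] -/
theorem offAP_apply : offAP kF LF ℓF kkF (boolPair (ones n) rb) = ones (offA k ℓ kk (qOf n k)) := by
  simp only [offAP, Function.comp_apply, fanoutFn_apply, nP, fstF_boolPair, hℓF, qP_apply hkF, hLF, hkkF, hkF, umulFn_boolPair,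
    appF_boolPair, ones_append, offA, offPb, offSg, offSd, offW]
  congr 1; ring

include hkF hLF hℓF hkkF hκF htF in
/-- Value of `runLenP`: `1^{runLen}`. [folklore] -/
theorem runLenP_apply : runLenP kF LF ℓF kkF κF tF (boolPair (ones n) rb) = ones (runLen n k ℓ kk t (qOf n k) κ) := by
  simp only [runLenP, Function.comp_apply, fanoutFn_apply, offAP_apply hkF hLF hℓF hkkF, nP, fstF_boolPair, hkF, htF, hκF,
    umulFn_boolPair, appF_boolPair, ones_append, runLen, offSt, stepLen]
  congr 1; ring

include hkF hLF hℓF hkkF hκF htF in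
/-- Value of `segP`: the run coins proper. [folklore] -/
theorem segP_apply : segP kF LF ℓF kkF κF tF (boolPair (ones n) rb) = rb.take (runLen n k ℓ kk t (qOf n k) κ) := by
  rw [segP, Function.comp_apply, fanoutFn_apply, runLenP_apply hkF hLF hℓF hkkF hκF htF, sndF_boolPair, takeFn_boolPair]
  simp [ones]

include hkF hLF in
/-- Value of `llkP`: `1^{L²k}`. [folklore] -/
theorem llkP_apply : llkP kF LF (boolPair (ones n) rb) = ones (2 ^ ℓ * 2 ^ ℓ * k) := by
  simp [llkP, nP, hkF, hLF, umulFn_boolPair]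

include hkF hLF hℓF hkkF hκF htF in
/-- **Value of `tblCtxP`**: CIKK's table context of the run read off the run coins. [folklore] -/
theorem tblCtxP_apply :
    tblCtxP kF LF ℓF kkF κF tF (boolPair (ones n) rb) =
      tblCtx (qOf n k) n k ℓ ((rb.take (runLen n k ℓ kk t (qOf n k) κ)).take ℓ)
        (((rb.take (runLen n k ℓ kk t (qOf n k) κ)).drop ℓ).take (qOf n k * qOf n k)) := by
  simp only [tblCtxP, fanoutFn_apply, Function.comp_apply, nP, fstF_boolPair, qP_apply hkF, hℓF, knkP_apply hkF, hLF, hkF,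
    segP_apply hkF hLF hℓF hkkF hκF htF, takeFn_boolPair, dropFn_boolPair, umulFn_boolPair, tblCtx, predHdr]
  simp [ones]

/-- The flat index of a table query decodes into `(j, c, blk)`. [folklore] -/
theorem tableIdx_decode {L K j c blk : ℕ} (hK : 0 < K) (hc : c < L) (hblk : blk < K) :
    ((j * L + c) * K + blk) / (L * K) = j ∧ ((j * L + c) * K + blk) % K = blk ∧ ((j * L + c) * K + blk) / K % L = c := by
  have hL : 0 < L := by omega
  have hLK : 0 < L * K := Nat.mul_pos hL hK
  have h1 : (j * L + c) * K + blk = j * (L * K) + (c * K + blk) := by ring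
  have hlt : c * K + blk < L * K := by nlinarith
  refine ⟨?_, ?_, ?_⟩
  · rw [h1, add_comm, Nat.add_mul_div_right _ _ hLK, Nat.div_eq_of_lt hlt, zero_add]
  · rw [Nat.add_mod, Nat.mul_mod_left, zero_add, Nat.mod_mod, Nat.mod_eq_of_lt hblk]
  · rw [add_comm, Nat.add_mul_div_right _ _ hK, Nat.div_eq_of_lt hblk, zero_add, Nat.add_mod, Nat.mul_mod_left, zero_add,
      Nat.mod_mod, Nat.mod_eq_of_lt hc]

include hkF hLF hℓF hkkF hκF htF in
/-- **Value of a table query** (`u = (jL + c)k + blk`): block `blk` of the pattern input of entry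
`(j, c)`, for the block and seed decoded from the run coins as CIKK's `coinsToRun` does.
[cite: CarmosinoImpagliazzoKabanetsKolokolova2016, §5 (step 2)] -/
theorem qryS_apply_table (hk : 0 < k) (hrb : runLen n k ℓ kk t (qOf n k) κ ≤ rb.length) {j c blk : ℕ}
    (hj : j < 2 ^ ℓ) (hc : c < 2 ^ ℓ) (hblk : blk < k) :
    qryS kF LF ℓF kkF κF tF (boolPair (boolPair (ones n) rb) (ones ((j * 2 ^ ℓ + c) * k + blk))) =
      List.ofFn fun d : Fin n =>
        patInput (qOf n k) ℓ (learnerDesign (qOf n k) n k ℓ (knk_le_qOf n k))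
          ((coinsToRun n k ℓ kk t (qOf n k) κ hk (rb.take (runLen n k ℓ kk t (qOf n k) κ))).1.1) ⟨j, hj⟩
          ((coinsToRun n k ℓ kk t (qOf n k) κ hk (rb.take (runLen n k ℓ kk t (qOf n k) κ))).1.2.1) c
          (ampIdxEquiv n k (Sum.inl (⟨blk, hblk⟩, d))) := by
  set seg := rb.take (runLen n k ℓ kk t (qOf n k) κ) with hseg
  have hsegl : seg.length = runLen n k ℓ kk t (qOf n k) κ := by rw [hseg, List.length_take, min_eq_left hrb]
  have hRL : ℓ + qOf n k * qOf n k ≤ runLen n k ℓ kk t (qOf n k) κ := by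
    simp only [runLen, offSt, offA, offPb, offSg, offSd, offW]; omega
  obtain ⟨hdj, hmb, hmc⟩ := tableIdx_decode (L := 2 ^ ℓ) (j := j) hk hc hblk
  have h1 : j * 2 ^ ℓ + c < 2 ^ ℓ * 2 ^ ℓ :=
    calc j * 2 ^ ℓ + c < j * 2 ^ ℓ + 2 ^ ℓ := by omega
      _ = (j + 1) * 2 ^ ℓ := by ring
      _ ≤ 2 ^ ℓ * 2 ^ ℓ := Nat.mul_le_mul_right _ hj
  have hlt : (j * 2 ^ ℓ + c) * k + blk < 2 ^ ℓ * 2 ^ ℓ * k :=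
    calc (j * 2 ^ ℓ + c) * k + blk < (j * 2 ^ ℓ + c) * k + k := by omega
      _ = (j * 2 ^ ℓ + c + 1) * k := by ring
      _ ≤ 2 ^ ℓ * 2 ^ ℓ * k := Nat.mul_le_mul_right _ h1
  -- the condition
  have hcond : (ltLenF ∘ fanoutFn sndF (llkP kF LF ∘ fstF)) (boolPair (boolPair (ones n) rb) (ones ((j * 2 ^ ℓ + c) * k + blk))) =
      [true] := by
    rw [Function.comp_apply, fanoutFn_apply, sndF_boolPair, Function.comp_apply, fstF_boolPair, llkP_apply hkF hLF, ltLenF_boolPair]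
    simp [ones, hlt]
  rw [qryS, iteFn_apply_true hcond]
  -- the fields of the run
  have hI : seg.take ℓ = List.ofFn ((boolFunEquivFin ℓ).symm (coinsToRun n k ℓ kk t (qOf n k) κ hk seg).1.1) := by
    rw [coinsToRun]; dsimp only
    rw [Equiv.symm_apply_apply, ← List.drop_zero (l := seg), drop_take_eq_ofFn_readBits seg (by rw [hsegl]; omega), List.drop_zero]
  have hZ : (seg.drop ℓ).take (qOf n k * qOf n k) = List.ofFn (coinsToRun n k ℓ kk t (qOf n k) κ hk seg).1.2.1 := by
    rw [coinsToRun]; dsimp only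
    rw [drop_take_eq_ofFn_readBits seg (by rw [hsegl]; exact hRL)]
  simp only [Function.comp_apply, fanoutFn_apply, fstF_boolPair, sndF_boolPair, nP, hkF, hLF, umulFn_boolPair, divModFn_boolPair,
    tblCtxP_apply hkF hLF hℓF hkkF hκF htF, ← hseg, hdj, hmb, hmc, hI, hZ, patInputFn_apply (knk_le_qOf n k) _ _ hj]
  exact blockFn_ofFn _ ⟨blk, hblk⟩

include hkF hLF hℓF hkkF hκF htF in
/-- **Value of a trusted-tuple query** (`u = L²k + blk`): the `blk`-th point of the trusted tuple,
as CIKK's `coinsToRun` reads it. [cite: CarmosinoImpagliazzoKabanetsKolokolova2016, §5 (step 5)] -/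
theorem qryS_apply_trusted (hk : 0 < k) (hrb : runLen n k ℓ kk t (qOf n k) κ ≤ rb.length) {blk : ℕ} (hblk : blk < k) :
    qryS kF LF ℓF kkF κF tF (boolPair (boolPair (ones n) rb) (ones (2 ^ ℓ * 2 ^ ℓ * k + blk))) =
      List.ofFn ((coinsToRun n k ℓ kk t (qOf n k) κ hk (rb.take (runLen n k ℓ kk t (qOf n k) κ))).2.2.2.1 ⟨blk, hblk⟩) := by
  set seg := rb.take (runLen n k ℓ kk t (qOf n k) κ) with hseg
  have hsegl : seg.length = runLen n k ℓ kk t (qOf n k) κ := by rw [hseg, List.length_take, min_eq_left hrb]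
  have hRA : offA k ℓ kk (qOf n k) + k * n ≤ runLen n k ℓ kk t (qOf n k) κ := by
    simp only [runLen, offSt]; omega
  have hc1 : (ltLenF ∘ fanoutFn sndF (llkP kF LF ∘ fstF)) (boolPair (boolPair (ones n) rb) (ones (2 ^ ℓ * 2 ^ ℓ * k + blk))) = [false] := by
    rw [Function.comp_apply, fanoutFn_apply, sndF_boolPair, Function.comp_apply, fstF_boolPair, llkP_apply hkF hLF, ltLenF_boolPair]
    simp [ones]
  have hc2 : (ltLenF ∘ fanoutFn sndF (appF ∘ fanoutFn (llkP kF LF ∘ fstF) (kF ∘ nP ∘ fstF)))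
      (boolPair (boolPair (ones n) rb) (ones (2 ^ ℓ * 2 ^ ℓ * k + blk))) = [true] := by
    rw [Function.comp_apply, fanoutFn_apply, sndF_boolPair, Function.comp_apply, fanoutFn_apply, Function.comp_apply, fstF_boolPair,
      llkP_apply hkF hLF, Function.comp_apply, Function.comp_apply, fstF_boolPair, nP, fstF_boolPair, hkF, appF_boolPair, ones_append,
      ltLenF_boolPair]
    simp [ones, hblk]
  rw [qryS, iteFn_apply_false hc1, iteFn_apply_true hc2]
  simp only [Function.comp_apply, fanoutFn_apply, fstF_boolPair, sndF_boolPair, nP, offAP_apply hkF hLF hℓF hkkF,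
    llkP_apply hkF hLF, segP_apply hkF hLF hℓF hkkF hκF htF, ← hseg, dropFn_boolPair, takeFn_boolPair, umulFn_boolPair, appF_boolPair,
    ones_append, ones, List.length_replicate, List.drop_replicate, Nat.add_sub_cancel_left]
  -- the slice is the trusted point
  have hkn : (blk + 1) * n ≤ k * n := Nat.mul_le_mul_right n (Nat.succ_le_of_lt hblk)
  have h2 : (blk + 1) * n = blk * n + n := by ring
  rw [drop_take_eq_ofFn_readBits seg (by rw [hsegl]; omega)]
  congr 1
  funext d
  rw [coinsToRun]; dsimp only
  have hd : blk * n + (d : ℕ) < k * n := by have := d.isLt; omega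
  simp only [readBits, slice, List.getD_eq_getElem?_getD, List.getElem?_take, List.getElem?_drop, if_pos hd]
  congr 2; ring

include hkF hLF in
/-- **Value of a dummy query** (`u ≥ L²k + k`): `0ⁿ`. [folklore] -/
theorem qryS_apply_dummy {u : ℕ} (hu : 2 ^ ℓ * 2 ^ ℓ * k + k ≤ u) :
    qryS kF LF ℓF kkF κF tF (boolPair (boolPair (ones n) rb) (ones u)) = List.replicate n false := by
  have hc1 : (ltLenF ∘ fanoutFn sndF (llkP kF LF ∘ fstF)) (boolPair (boolPair (ones n) rb) (ones u)) = [false] := by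
    rw [Function.comp_apply, fanoutFn_apply, sndF_boolPair, Function.comp_apply, fstF_boolPair, llkP_apply hkF hLF, ltLenF_boolPair]
    simp [ones]; omega
  have hc2 : (ltLenF ∘ fanoutFn sndF (appF ∘ fanoutFn (llkP kF LF ∘ fstF) (kF ∘ nP ∘ fstF)))
      (boolPair (boolPair (ones n) rb) (ones u)) = [false] := by
    rw [Function.comp_apply, fanoutFn_apply, sndF_boolPair, Function.comp_apply, fanoutFn_apply, Function.comp_apply, fstF_boolPair,
      llkP_apply hkF hLF, Function.comp_apply, Function.comp_apply, fstF_boolPair, nP, fstF_boolPair, hkF, appF_boolPair, ones_append,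
      ltLenF_boolPair]
    simp [ones]; omega
  rw [qryS, iteFn_apply_false hc1, iteFn_apply_false hc2]
  simp [nP, ones]

include hkF hLF hℓF hkkF hκF htF in
/-- **Value of a table query, by its flat index** `u < L²k`: block `u mod k` of the pattern input of
entry `(u / (Lk), (u / k) mod L)`. [cite: CarmosinoImpagliazzoKabanetsKolokolova2016, §5 (step 2)] -/
theorem qryS_apply_lt (hk : 0 < k) (hrb : runLen n k ℓ kk t (qOf n k) κ ≤ rb.length) {u : ℕ} (hu : u < 2 ^ ℓ * 2 ^ ℓ * k) :
    qryS kF LF ℓF kkF κF tF (boolPair (boolPair (ones n) rb) (ones u)) =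
      List.ofFn fun d : Fin n =>
        patInput (qOf n k) ℓ (learnerDesign (qOf n k) n k ℓ (knk_le_qOf n k))
          ((coinsToRun n k ℓ kk t (qOf n k) κ hk (rb.take (runLen n k ℓ kk t (qOf n k) κ))).1.1)
          ⟨u / (2 ^ ℓ * k), (Nat.div_lt_iff_lt_mul (Nat.mul_pos (Nat.two_pow_pos ℓ) hk)).2 (by simpa [mul_comm, mul_assoc, mul_left_comm] using hu)⟩
          ((coinsToRun n k ℓ kk t (qOf n k) κ hk (rb.take (runLen n k ℓ kk t (qOf n k) κ))).1.2.1) (u / k % 2 ^ ℓ)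
          (ampIdxEquiv n k (Sum.inl (⟨u % k, Nat.mod_lt _ hk⟩, d))) := by
  set seg := rb.take (runLen n k ℓ kk t (qOf n k) κ) with hseg
  have hsegl : seg.length = runLen n k ℓ kk t (qOf n k) κ := by rw [hseg, List.length_take, min_eq_left hrb]
  have hRL : ℓ + qOf n k * qOf n k ≤ runLen n k ℓ kk t (qOf n k) κ := by
    have h2ℓ : 0 < 2 ^ ℓ := Nat.two_pow_pos ℓ
    simp only [runLen, offSt, offA, offPb, offSg, offSd, offW]; omega
  have hcond : (ltLenF ∘ fanoutFn sndF (llkP kF LF ∘ fstF)) (boolPair (boolPair (ones n) rb) (ones u)) = [true] := by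
    rw [Function.comp_apply, fanoutFn_apply, sndF_boolPair, Function.comp_apply, fstF_boolPair, llkP_apply hkF hLF, ltLenF_boolPair]
    simp [ones, hu]
  rw [qryS, iteFn_apply_true hcond]
  have hI : seg.take ℓ = List.ofFn ((boolFunEquivFin ℓ).symm (coinsToRun n k ℓ kk t (qOf n k) κ hk seg).1.1) := by
    rw [coinsToRun]; dsimp only
    rw [Equiv.symm_apply_apply, ← List.drop_zero (l := seg), drop_take_eq_ofFn_readBits seg (by rw [hsegl]; omega), List.drop_zero]
  have hZ : (seg.drop ℓ).take (qOf n k * qOf n k) = List.ofFn (coinsToRun n k ℓ kk t (qOf n k) κ hk seg).1.2.1 := by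
    rw [coinsToRun]; dsimp only
    rw [drop_take_eq_ofFn_readBits seg (by rw [hsegl]; exact hRL)]
  have hj : u / (2 ^ ℓ * k) < 2 ^ ℓ :=
    (Nat.div_lt_iff_lt_mul (Nat.mul_pos (Nat.two_pow_pos ℓ) hk)).2 (by simpa [mul_comm, mul_assoc, mul_left_comm] using hu)
  simp only [Function.comp_apply, fanoutFn_apply, fstF_boolPair, sndF_boolPair, nP, hkF, hLF, umulFn_boolPair, divModFn_boolPair,
    tblCtxP_apply hkF hLF hℓF hkkF hκF htF, ← hseg, hI, hZ, patInputFn_apply (knk_le_qOf n k) _ _ hj]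
  exact blockFn_ofFn _ ⟨u % k, Nat.mod_lt _ hk⟩

include hkF hLF hℓF hkkF hκF htF in
/-- **Every run query has length `n`** (the hypothesis `hQlen` of `IWUniform.reducibleUsing_of_weakStage`,
for ANY number of queries: past `L²k + k` the queries are the dummy `0ⁿ`). [folklore] -/
theorem length_qryS (hk : 0 < k) (hrb : runLen n k ℓ kk t (qOf n k) κ ≤ rb.length) (u : ℕ) :
    (qryS kF LF ℓF kkF κF tF (boolPair (boolPair (ones n) rb) (ones u))).length = n := by
  by_cases h1 : u < 2 ^ ℓ * 2 ^ ℓ * k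
  · rw [qryS_apply_lt hkF hLF hℓF hkkF hκF htF rb hk hrb h1, List.length_ofFn]
  · by_cases h2 : u < 2 ^ ℓ * 2 ^ ℓ * k + k
    · obtain ⟨blk, rfl⟩ := Nat.exists_eq_add_of_le (not_lt.1 h1)
      rw [qryS_apply_trusted hkF hLF hℓF hkkF hκF htF rb hk hrb (by omega), List.length_ofFn]
    · rw [qryS_apply_dummy hkF hLF rb (not_lt.1 h2), List.length_replicate]

end Values

end IWStage

end Literature.Computability.Complexity

end
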